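import Literature.NumberTheory.EllipticCurves.Hida2010MuInvariant.AnticyclotomicKatzBranchMuInvariant
import Literature.NumberTheory.LFunctions.DworkRationalityTeichmuller
import HarnessLib

/-!
# The first-unit index of a series in `𝓞_{ℂ_p}⟦T⟧`: the order of its reduction, invariance under units,
# and its reading on a `ℤ_p`-form along a structure map
# (helper file for crux 2 `GoodLatticeBDPValue`, stmt-BirchSwinnertonDyer-19032, line `halves`, stub 3
# `stub_anDS`, piece AN-F₁ `KatzLineIntFrameAt`; seat `bsd-line-x1-p1-w2` gen 2)

The CGLS currency "`μ = 0` and `λ = n`" for a series `Q ∈ 𝓞_{ℂ_p}⟦T⟧` is the token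
`‖[T^n]Q‖ = 1 ∧ ∀ i < n, ‖[T^i]Q‖ < 1` (the body of `KellerYin2024.FirstUnitCoeffAt` over the wide
receptacle; the idea file's `IntFirstUnitCoeffAt`). This file proves, with no new definition:

* §1 `firstUnit_iff_order_map_residue`: the token holds at `n` iff the reduction of `Q` modulo the
  maximal ideal `𝔪` of the local ring `𝓞_{ℂ_p}` has order `n` in `k⟦T⟧` (`k = 𝓞_{ℂ_p}/𝔪`; the residue
  tests are the tree's `Dwork.residue_eq_zero_iff'` and `isUnit_padicComplexInt_iff`).
* §2 `firstUnit_mul_iff_of_isUnit`, `firstUnit_congr_of_associated`, `firstUnit_C_mul_iff`: the token is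
  invariant under multiplication by a unit of `𝓞_{ℂ_p}⟦T⟧` (in particular by a unit constant and by a
  series with unit constant term): Gauss's lemma for `λ`, `ord(Ū·Q̄) = ord(Q̄)`.
* §3 `firstUnit_map_iff_order_map_residue`: along a structure map `J : ℤ_p → 𝓞_{ℂ_p}` (compatible with
  `ℤ_p ⊂ ℚ_p ⊂ ℂ_p`) the token for `g.map J` at `n` is `ord(g mod p) = n`; hence
  `firstUnit_of_associated_map` — if `g.map J ~ Q` in `𝓞_{ℂ_p}⟦T⟧` and `g mod p ≠ 0` then `Q` has its
  first unit coefficient at `ord(g mod p)`.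

Pure commutative algebra; no fact, no definition, no `sorry`; nothing about BSD.
References: Washington 1997 §7.1 Prop. 7.2 (`μ`, `λ` of a power series); Greenberg–Vatsal 2000 p. 2 (1)–(2).
-/

-- the summit namespace `Summit.BirchSwinnertonDyer.BirchSwinnertonDyer` repeats the problem name by design (D-0017)
set_option linter.dupNamespace false
set_option autoImplicit false

noncomputable section

open scoped Classical

open PowerSeries Literature.NumberTheory.EllipticCurves

namespace Summit.BirchSwinnertonDyer.BirchSwinnertonDyer.Theorems.KatzLineFrame

variable {p : ℕ} [Fact p.Prime]

/-! ## §1 The token = the order of the reduction -/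

/-- An element of `𝓞_{ℂ_p}` has norm `1` iff its residue is non-zero. [cite: Washington1997, §7.1 Prop. 7.2] -/
theorem residue_ne_zero_iff_norm_eq_one (x : 𝓞_ℂ_[p]) :
    IsLocalRing.residue 𝓞_ℂ_[p] x ≠ 0 ↔ ‖(x : ℂ_[p])‖ = 1 := by
  rw [IsLocalRing.residue_ne_zero_iff_isUnit, isUnit_padicComplexInt_iff]

/-- **The first-unit index is the order of the reduction**: `‖[T^n]Q‖ = 1 ∧ ∀ i < n, ‖[T^i]Q‖ < 1` iff
`ord(Q mod 𝔪) = n` in `k⟦T⟧`. [cite: Washington1997, §7.1 Prop. 7.2] -/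
theorem firstUnit_iff_order_map_residue (Q : PowerSeries 𝓞_ℂ_[p]) (n : ℕ) :
    (‖((coeff n Q : 𝓞_ℂ_[p]) : ℂ_[p])‖ = 1 ∧ ∀ i < n, ‖((coeff i Q : 𝓞_ℂ_[p]) : ℂ_[p])‖ < 1) ↔
      (Q.map (IsLocalRing.residue 𝓞_ℂ_[p])).order = n := by
  rw [order_eq_nat]
  simp only [coeff_map, residue_ne_zero_iff_norm_eq_one,
    Literature.NumberTheory.LFunctions.Dwork.residue_eq_zero_iff']

/-! ## §2 Invariance under units of `𝓞_{ℂ_p}⟦T⟧` -/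

/-- The reduction of a unit of `R⟦T⟧` (`R` local with residue field `k`) has order `0` in `k⟦T⟧`.
[cite: Washington1997, §7.1 Prop. 7.2] -/
theorem order_map_residue_eq_zero_of_isUnit {R : Type*} [CommRing R] [IsLocalRing R]
    {U : PowerSeries R} (hU : IsUnit U) :
    (U.map (IsLocalRing.residue R)).order = 0 := by
  have hU' : IsUnit (constantCoeff (U.map (IsLocalRing.residue R))) :=
    PowerSeries.isUnit_iff_constantCoeff.mp (hU.map (PowerSeries.map (IsLocalRing.residue R)))
  have h0 : coeff 0 (U.map (IsLocalRing.residue R)) ≠ 0 := by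
    rw [coeff_zero_eq_constantCoeff]
    exact hU'.ne_zero
  exact_mod_cast order_eq_nat.mpr ⟨h0, fun i hi ↦ (Nat.not_lt_zero i hi).elim⟩

/-- **A unit factor does not move the first-unit index** (`ord(Ū·Q̄) = ord(Ū) + ord(Q̄) = ord(Q̄)` in the
domain `k⟦T⟧`). [cite: Washington1997, §7.1 Prop. 7.2] -/
theorem firstUnit_mul_iff_of_isUnit {U : PowerSeries 𝓞_ℂ_[p]} (hU : IsUnit U)
    (Q : PowerSeries 𝓞_ℂ_[p]) (n : ℕ) :
    (‖((coeff n (U * Q) : 𝓞_ℂ_[p]) : ℂ_[p])‖ = 1 ∧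
        ∀ i < n, ‖((coeff i (U * Q) : 𝓞_ℂ_[p]) : ℂ_[p])‖ < 1) ↔
      (‖((coeff n Q : 𝓞_ℂ_[p]) : ℂ_[p])‖ = 1 ∧ ∀ i < n, ‖((coeff i Q : 𝓞_ℂ_[p]) : ℂ_[p])‖ < 1) := by
  rw [firstUnit_iff_order_map_residue, firstUnit_iff_order_map_residue, map_mul, order_mul,
    order_map_residue_eq_zero_of_isUnit hU, zero_add]

/-- **Associated series have the same first-unit index.** [cite: Washington1997, §7.1 Prop. 7.2] -/
theorem firstUnit_congr_of_associated {Q Q' : PowerSeries 𝓞_ℂ_[p]} (h : Associated Q Q') (n : ℕ) :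
    (‖((coeff n Q : 𝓞_ℂ_[p]) : ℂ_[p])‖ = 1 ∧ ∀ i < n, ‖((coeff i Q : 𝓞_ℂ_[p]) : ℂ_[p])‖ < 1) ↔
      (‖((coeff n Q' : 𝓞_ℂ_[p]) : ℂ_[p])‖ = 1 ∧ ∀ i < n, ‖((coeff i Q' : 𝓞_ℂ_[p]) : ℂ_[p])‖ < 1) := by
  obtain ⟨u, rfl⟩ := h
  rw [mul_comm, firstUnit_mul_iff_of_isUnit u.isUnit]

/-- **A unit constant does not move the first-unit index** (`c ∈ 𝓞_{ℂ_p}` with `‖c‖ = 1`).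
[cite: Washington1997, §7.1 Prop. 7.2] -/
theorem firstUnit_C_mul_iff {c : 𝓞_ℂ_[p]} (hc : ‖(c : ℂ_[p])‖ = 1) (Q : PowerSeries 𝓞_ℂ_[p]) (n : ℕ) :
    (‖((coeff n (C c * Q) : 𝓞_ℂ_[p]) : ℂ_[p])‖ = 1 ∧
        ∀ i < n, ‖((coeff i (C c * Q) : 𝓞_ℂ_[p]) : ℂ_[p])‖ < 1) ↔
      (‖((coeff n Q : 𝓞_ℂ_[p]) : ℂ_[p])‖ = 1 ∧ ∀ i < n, ‖((coeff i Q : 𝓞_ℂ_[p]) : ℂ_[p])‖ < 1) :=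
  firstUnit_mul_iff_of_isUnit ((isUnit_padicComplexInt_iff.mpr hc).map (C (R := 𝓞_ℂ_[p]))) Q n

/-! ## §3 Reading the index on a `ℤ_p`-form along a structure map -/

/-- Along a structure map `J : ℤ_p → 𝓞_{ℂ_p}` (compatible with `ℤ_p ⊂ ℚ_p ⊂ ℂ_p`) norms are preserved.
[folklore] -/
theorem norm_structureMap_eq {J : ℤ_[p] →+* 𝓞_ℂ_[p]}
    (hJ : ∀ x : ℤ_[p], ((J x : 𝓞_ℂ_[p]) : ℂ_[p]) = ((x : ℚ_[p]) : ℂ_[p])) (x : ℤ_[p]) :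
    ‖((J x : 𝓞_ℂ_[p]) : ℂ_[p])‖ = ‖x‖ := by
  rw [hJ, PadicComplex.norm_extends' p, PadicInt.padic_norm_e_of_padicInt]

omit [Fact p.Prime] in
/-- An element of `ℤ_p` has norm `< 1` iff its residue mod `p` vanishes. [folklore] -/
theorem padicInt_residue_eq_zero_iff_norm_lt_one [Fact p.Prime] (x : ℤ_[p]) :
    IsLocalRing.residue ℤ_[p] x = 0 ↔ ‖x‖ < 1 := by
  rw [IsLocalRing.residue_eq_zero_iff, IsLocalRing.mem_maximalIdeal, PadicInt.mem_nonunits]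

omit [Fact p.Prime] in
/-- An element of `ℤ_p` has norm `1` iff its residue mod `p` is non-zero. [folklore] -/
theorem padicInt_residue_ne_zero_iff_norm_eq_one [Fact p.Prime] (x : ℤ_[p]) :
    IsLocalRing.residue ℤ_[p] x ≠ 0 ↔ ‖x‖ = 1 := by
  rw [IsLocalRing.residue_ne_zero_iff_isUnit, PadicInt.isUnit_iff]

/-- **The first-unit index of `g.map J` is `ord(g mod p)`.** [cite: Washington1997, §7.1 Prop. 7.2] -/
theorem firstUnit_map_iff_order_map_residue {J : ℤ_[p] →+* 𝓞_ℂ_[p]}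
    (hJ : ∀ x : ℤ_[p], ((J x : 𝓞_ℂ_[p]) : ℂ_[p]) = ((x : ℚ_[p]) : ℂ_[p]))
    (g : PowerSeries ℤ_[p]) (n : ℕ) :
    (‖((coeff n (g.map J) : 𝓞_ℂ_[p]) : ℂ_[p])‖ = 1 ∧
        ∀ i < n, ‖((coeff i (g.map J) : 𝓞_ℂ_[p]) : ℂ_[p])‖ < 1) ↔
      (g.map (IsLocalRing.residue ℤ_[p])).order = n := by
  rw [order_eq_nat]
  simp only [coeff_map, norm_structureMap_eq hJ, padicInt_residue_ne_zero_iff_norm_eq_one,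
    padicInt_residue_eq_zero_iff_norm_lt_one]

/-- **From the `ℤ_p`-form to any associate in `𝓞_{ℂ_p}⟦T⟧`**: if `g.map J ~ Q` and `g mod p ≠ 0` then `Q`
has its first unit coefficient at `ord(g mod p)` (as a natural number). [cite: Washington1997, §7.1 Prop. 7.2] -/
theorem firstUnit_of_associated_map {J : ℤ_[p] →+* 𝓞_ℂ_[p]}
    (hJ : ∀ x : ℤ_[p], ((J x : 𝓞_ℂ_[p]) : ℂ_[p]) = ((x : ℚ_[p]) : ℂ_[p]))
    {g : PowerSeries ℤ_[p]} {Q : PowerSeries 𝓞_ℂ_[p]} (h : Associated (g.map J) Q)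
    (hg : g.map (IsLocalRing.residue ℤ_[p]) ≠ 0) :
    ‖((coeff (g.map (IsLocalRing.residue ℤ_[p])).order.toNat Q : 𝓞_ℂ_[p]) : ℂ_[p])‖ = 1 ∧
      ∀ i < (g.map (IsLocalRing.residue ℤ_[p])).order.toNat,
        ‖((coeff i Q : 𝓞_ℂ_[p]) : ℂ_[p])‖ < 1 := by
  rw [← firstUnit_congr_of_associated h, firstUnit_map_iff_order_map_residue hJ]
  exact (ENat.coe_toNat (order_eq_top.not.mpr hg)).symm

end Summit.BirchSwinnertonDyer.BirchSwinnertonDyer.Theorems.KatzLineFrame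

end
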